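import Summits.Ventures.Crystal3D.Theorems.StickyWulffConstantGenericWallFloorStackWalkReverse
import Summits.Ventures.Crystal3D.Theorems.StickyWulffConstantGenericWallFloorStackLedgerTools
import HarnessLib

/-!
# The map `top ↦ end STATE` of the stack walk is injective (crux `GenericWallFloor`, line `WallLedgerG`;
# fourth brick of the MERGE LOCALISATION of the stack ledger's residual `LOST`)

HONEST FRAMING. Part of the venture `Summits/Ventures/Crystal3D` (cell `crystal3d-full`), helper
`--supports` the crux `GenericWallFloor` (stmt-Ventures-19480) of `route-Ventures-StickyWulffConstant`,
registered line `WallLedgerG`, open stub `stub_twoSlabAdhesion` (general fillings).  Sequel of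
`…StackWalkReverse` (one step of the walk is injective on sound well-formed states).

* `walkStep_walkInv`, `walkRun_valid` — validity (`WalkInv ∧ StackWF`) along a run.
* `orbit_pull`, **`walkRun_eq_walkRun_orbit`** — if two valid states have the same position after `N` steps,
  one lies on the orbit of the other (backward determinism, with care for stopped walkers).
* `walkRun_height_mono` — heights never decrease along a run.
* `walkRun_deep_prefix` — while a walker launched from a top `t′` of a complete sample is still at height
  `≤ H` (the top of the sealed window) it has made only FULL steps: it sits at `t′ + (k+1)·A u` with the bottom
  stack.
* `walkRun_ne_start` — a walker never visits the START state of another top of the same sample (a visit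
  would put the two tops on one steep line with the lower one not a top — the sample is an interval along
  every line).
* **`walkRun_start_injective`** — hence `t ↦ walkRun N (t + A u, [⟨A, u, 0⟩])` is injective on the tops.
Stated for one grain with an abstract unit vertical `z` (grain 1: `z = e₃`; grain 2: `z = −e₃`) and the
sample's window given by hypotheses, as consumed by the localised stack ledger (next bricks).

WHAT THIS IS NOT: not the stub; `ExactOnly` (C12-55) is an input (as in `…StackWalk`); F-C1 not moved.
-/

noncomputable section

namespace Summit.Ventures.Crystal3D.Theorems

open Finset
open Literature.MathematicalPhysics.StatisticalMechanics (fccStacking)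
open scoped InnerProductSpace

variable {X : Finset (EuclideanSpace ℝ (Fin 3))}

/-! ### Validity along runs -/

/-- A successful step from a valid state lands in a state satisfying `WalkInv`, one unit away, not lower. -/
theorem walkStep_walkInv (hX : ∀ p ∈ X, ∀ q ∈ X, p ≠ q → 1 ≤ dist p q)
    {s₀ : EuclideanSpace ℝ (Fin 3)} (hs₀ : s₀ ∈ fccSlots)
    (hcert : ExactOnly 0 (fccSlots.filter fun w => 0 < ⟪w, s₀⟫_ℝ))
    {z : EuclideanSpace ℝ (Fin 3)} (hz : ‖z‖ = 1) {s s' : EuclideanSpace ℝ (Fin 3) × List WalkEntry}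
    (hI : WalkInv X z s) (h : walkStep X z s = some s') :
    WalkInv X z s' ∧ ‖s'.1 - s.1‖ = 1 ∧ (3 / 8 : ℝ) ≤ ⟪s'.1 - s.1, z⟫_ℝ := by
  rcases walkStep_spec hX hs₀ hcert hz hI with ⟨hnone, -⟩ | ⟨s'', hsome, hI', hn, hr⟩
  · rw [hnone] at h; exact absurd h (by simp)
  · rw [hsome] at h
    obtain rfl := Option.some.inj h
    exact ⟨hI', hn, hr⟩

/-- Validity (`WalkInv ∧ StackWF`) is preserved along a run. -/
theorem walkRun_valid (hX : ∀ p ∈ X, ∀ q ∈ X, p ≠ q → 1 ≤ dist p q)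
    {s₀ : EuclideanSpace ℝ (Fin 3)} (hs₀ : s₀ ∈ fccSlots)
    (hcert : ExactOnly 0 (fccSlots.filter fun w => 0 < ⟪w, s₀⟫_ℝ))
    {z : EuclideanSpace ℝ (Fin 3)} (hz : ‖z‖ = 1) (k : ℕ) {s : EuclideanSpace ℝ (Fin 3) × List WalkEntry}
    (hI : WalkInv X z s) (hW : StackWF z s.2) :
    WalkInv X z (walkRun X z k s) ∧ StackWF z (walkRun X z k s).2 :=
  ⟨(walkRun_spec hX hs₀ hcert hz k s hI).1, walkRun_stackWF k s hW⟩

/-- Heights never decrease along a run. -/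
theorem walkRun_height_mono (hX : ∀ p ∈ X, ∀ q ∈ X, p ≠ q → 1 ≤ dist p q)
    {s₀ : EuclideanSpace ℝ (Fin 3)} (hs₀ : s₀ ∈ fccSlots)
    (hcert : ExactOnly 0 (fccSlots.filter fun w => 0 < ⟪w, s₀⟫_ℝ))
    {z : EuclideanSpace ℝ (Fin 3)} (hz : ‖z‖ = 1) {s : EuclideanSpace ℝ (Fin 3) × List WalkEntry}
    (hI : WalkInv X z s) (k : ℕ) :
    ⟪(walkRun X z k s).1, z⟫_ℝ ≤ ⟪(walkRun X z (k + 1) s).1, z⟫_ℝ := by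
  rw [walkRun_succ']
  have hIk := (walkRun_spec hX hs₀ hcert hz k s hI).1
  obtain ⟨-, hdisp, -⟩ := walkRun_spec hX hs₀ hcert hz 1 _ hIk
  have h0 : 0 ≤ ⟪(walkRun X z 1 (walkRun X z k s)).1 - (walkRun X z k s).1, z⟫_ℝ := by
    nlinarith [norm_nonneg ((walkRun X z 1 (walkRun X z k s)).1 - (walkRun X z k s).1)]
  rw [inner_sub_left] at h0
  linarith

/-! ### Orbits -/

/-- **Pulling back along an orbit.**  If `x → y` and `x′ → y′` are steps of valid states and `y′` is on the
orbit of `y`, then `x′` is on the orbit of `x`. -/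
theorem orbit_pull (hX : ∀ p ∈ X, ∀ q ∈ X, p ≠ q → 1 ≤ dist p q)
    {s₀ : EuclideanSpace ℝ (Fin 3)} (hs₀ : s₀ ∈ fccSlots)
    (hcert : ExactOnly 0 (fccSlots.filter fun w => 0 < ⟪w, s₀⟫_ℝ))
    {z : EuclideanSpace ℝ (Fin 3)} (hz : ‖z‖ = 1) :
    ∀ (j : ℕ) {x x' y y' : EuclideanSpace ℝ (Fin 3) × List WalkEntry},
      WalkInv X z x → StackWF z x.2 → WalkInv X z x' → StackWF z x'.2 →
      walkStep X z x = some y → walkStep X z x' = some y' → walkRun X z j y = y' →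
      ∃ j', walkRun X z j' x = x'
  | 0, x, x', y, y', hI, hW, hI', hW', hx, hx', h => by
    rw [walkRun_zero] at h
    subst h
    exact ⟨0, walkStep_injective hX hI.2.1 hW hI'.2.1 hW' hx hx'⟩
  | j + 1, x, x', y, y', hI, hW, hI', hW', hx, hx', h => by
    rw [walkRun_succ'] at h
    obtain ⟨hyI, -, -⟩ := walkStep_walkInv hX hs₀ hcert hz hI hx
    have hyW : StackWF z y.2 := walkStep_stackWF hW hx
    obtain ⟨hwI, hwW⟩ := walkRun_valid hX hs₀ hcert hz j hyI hyW
    cases hw : walkStep X z (walkRun X z j y) with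
    | none =>
      rw [walkRun_succ_of_none X z 0 hw] at h
      exact orbit_pull hX hs₀ hcert hz j hI hW hI' hW' hx hx' h
    | some v =>
      rw [walkRun_succ_of_some X z 0 hw, walkRun_zero] at h
      subst h
      have heq : walkRun X z j y = x' := walkStep_injective hX hwI.2.1 hwW hI'.2.1 hW' hw hx'
      exact ⟨j + 1, by rw [walkRun_succ_of_some X z j hx, heq]⟩

/-- **Equal positions after `N` steps put one valid state on the other's orbit.** -/
theorem walkRun_eq_walkRun_orbit (hX : ∀ p ∈ X, ∀ q ∈ X, p ≠ q → 1 ≤ dist p q)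
    {s₀ : EuclideanSpace ℝ (Fin 3)} (hs₀ : s₀ ∈ fccSlots)
    (hcert : ExactOnly 0 (fccSlots.filter fun w => 0 < ⟪w, s₀⟫_ℝ))
    {z : EuclideanSpace ℝ (Fin 3)} (hz : ‖z‖ = 1) :
    ∀ (N : ℕ) {x x' : EuclideanSpace ℝ (Fin 3) × List WalkEntry},
      WalkInv X z x → StackWF z x.2 → WalkInv X z x' → StackWF z x'.2 →
      walkRun X z N x = walkRun X z N x' → (∃ j, walkRun X z j x = x') ∨ (∃ j, walkRun X z j x' = x)
  | 0, x, x', _, _, _, _, h => Or.inl ⟨0, h⟩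
  | N + 1, x, x', hI, hW, hI', hW', h => by
    cases hx : walkStep X z x with
    | none =>
      rw [walkRun_succ_of_none X z N hx] at h
      exact Or.inr ⟨N + 1, h.symm⟩
    | some y =>
      cases hx' : walkStep X z x' with
      | none =>
        rw [walkRun_succ_of_none X z N hx'] at h
        exact Or.inl ⟨N + 1, h⟩
      | some y' =>
        rw [walkRun_succ_of_some X z N hx, walkRun_succ_of_some X z N hx'] at h
        obtain ⟨hyI, -, -⟩ := walkStep_walkInv hX hs₀ hcert hz hI hx
        obtain ⟨hyI', -, -⟩ := walkStep_walkInv hX hs₀ hcert hz hI' hx'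
        have hyW : StackWF z y.2 := walkStep_stackWF hW hx
        have hyW' : StackWF z y'.2 := walkStep_stackWF hW' hx'
        rcases walkRun_eq_walkRun_orbit hX hs₀ hcert hz N hyI hyW hyI' hyW' h with ⟨j, hj⟩ | ⟨j, hj⟩
        · exact Or.inl (orbit_pull hX hs₀ hcert hz j hI hW hI' hW' hx hx' hj)
        · exact Or.inr (orbit_pull hX hs₀ hcert hz j hI' hW' hI hW hx' hx hj)

/-! ### One grain: the deep prefix of a walk and the non-revisiting of start states -/

/-- Natural multiples of a lattice vector stay in the lattice. -/
theorem add_natCast_smul_mem_fcc {q u : EuclideanSpace ℝ (Fin 3)} (hq : q ∈ fccStacking 1 (Real.sqrt (2 / 3)))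
    (hu : u ∈ fccStacking 1 (Real.sqrt (2 / 3))) :
    ∀ k : ℕ, q + (k : ℝ) • u ∈ fccStacking 1 (Real.sqrt (2 / 3))
  | 0 => by simpa using hq
  | k + 1 => by
    have h := fcc_add_site_mem (add_natCast_smul_mem_fcc hq hu k) hu
    have e : q + (k : ℝ) • u + u = q + ((k + 1 : ℕ) : ℝ) • u := by push_cast; module
    rw [e] at h; exact h

section Grain

variable (hX : ∀ p ∈ X, ∀ q ∈ X, p ≠ q → 1 ≤ dist p q)
  {s₀ : EuclideanSpace ℝ (Fin 3)} (hs₀ : s₀ ∈ fccSlots)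
  (hcert : ExactOnly 0 (fccSlots.filter fun w => 0 < ⟪w, s₀⟫_ℝ))
  {z : EuclideanSpace ℝ (Fin 3)} (hz : ‖z‖ = 1)
  (A : EuclideanSpace ℝ (Fin 3) ≃ₗᵢ[ℝ] EuclideanSpace ℝ (Fin 3)) (t₀ : EuclideanSpace ℝ (Fin 3))
  {u : EuclideanSpace ℝ (Fin 3)} (hu : u ∈ fccSlots) (hsteep : Real.sqrt 2 / 2 ≤ ⟪A u, z⟫_ℝ)
  (S : Finset (EuclideanSpace ℝ (Fin 3))) {hlo Hd ρs ρ' : ℝ} (hρs : 0 ≤ ρs)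
  (hS : ∀ p ∈ S, p ∈ X ∧ p ∈ (fun q => A q + t₀) '' fccStacking 1 (Real.sqrt (2 / 3)) ∧
    hlo ≤ ⟪p, z⟫_ℝ ∧ ⟪p, z⟫_ℝ ≤ Hd ∧ p 0 ^ 2 + p 1 ^ 2 ≤ ρs ^ 2)
  (hfullS : ∀ p ∈ S, ∀ w ∈ fccSlots, p + A w ∈ X)
  (hdeep : ∀ p ∈ X, p ∈ (fun q => A q + t₀) '' fccStacking 1 (Real.sqrt (2 / 3)) →
    hlo ≤ ⟪p, z⟫_ℝ → ⟪p, z⟫_ℝ ≤ Hd → Real.sqrt (p 0 ^ 2 + p 1 ^ 2) ≤ ρ' → ∀ w ∈ fccSlots, p + A w ∈ X)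
  (hroom : ρs + 2 * (Hd - hlo) ≤ ρ')
  (hconv : ∀ p ∈ S, ∀ i : ℕ, 1 ≤ i → p + ((i : ℕ) : ℝ) • A u ∈ S → p + A u ∈ S)

include hX hs₀ hcert hz hu hsteep hρs hS hfullS hdeep hroom in
/-- **The deep prefix.**  A walker launched from `t′ ∈ S` that is still at height `≤ Hd` after `k` steps has
made `k` FULL steps along `A u` and carries the bottom stack. -/
theorem walkRun_deep_prefix {t' : EuclideanSpace ℝ (Fin 3)} (ht' : t' ∈ S) (k : ℕ)
    (hk : ⟪(walkRun X z k (t' + A u, [⟨A, u, 0⟩])).1, z⟫_ℝ ≤ Hd) :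
    walkRun X z k (t' + A u, [⟨A, u, 0⟩]) = (t' + A u + (k : ℝ) • A u, [⟨A, u, 0⟩]) := by
  induction k with
  | zero => simp
  | succ k IH =>
    obtain ⟨ht'X, ht'Λ, ht'lo, -, ht'r⟩ := hS t' ht'
    have hI₀ : WalkInv X z (t' + A u, [⟨A, u, 0⟩]) := walkInv_start A ht'X (hfullS t' ht') hu hsteep
    have hmono := walkRun_height_mono hX hs₀ hcert hz hI₀ k
    have hk' : ⟪(walkRun X z k (t' + A u, [⟨A, u, 0⟩])).1, z⟫_ℝ ≤ Hd := hmono.trans hk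
    have IH' := IH hk'
    set b : EuclideanSpace ℝ (Fin 3) := t' + A u + (k : ℝ) • A u with hb
    have hbX : b ∈ X := by
      have := (walkRun_spec hX hs₀ hcert hz k _ hI₀).1.1
      rw [IH'] at this; exact this
    -- `b` is a lattice ball in the sealed window: full
    have huz : 0 < ⟪A u, z⟫_ℝ := lt_of_lt_of_le (by positivity) hsteep
    have hbz : ⟪b, z⟫_ℝ = ⟪t', z⟫_ℝ + ((k : ℝ) + 1) * ⟪A u, z⟫_ℝ := by
      rw [hb, inner_add_left, inner_add_left, real_inner_smul_left]; ring
    have hblo : hlo ≤ ⟪b, z⟫_ℝ := by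
      rw [hbz]; nlinarith
    have hbHd : ⟪b, z⟫_ℝ ≤ Hd := by rw [IH'] at hk'; exact hk'
    have hk1 : ((k : ℝ) + 1) * ⟪A u, z⟫_ℝ ≤ Hd - hlo := by linarith
    have hs2 : (7 / 10 : ℝ) ≤ Real.sqrt 2 / 2 := by
      rw [le_div_iff₀ (by norm_num : (0:ℝ) < 2)]
      have : (7 / 10 * 2 : ℝ) = Real.sqrt ((7 / 5) ^ 2) := by rw [Real.sqrt_sq (by norm_num)]; norm_num
      rw [this]; exact Real.sqrt_le_sqrt (by norm_num)
    have hk2 : (k : ℝ) + 1 ≤ 2 * (Hd - hlo) := by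
      have h0 : 0 ≤ (k : ℝ) + 1 := by positivity
      nlinarith [hk1, hs2, hsteep, h0]
    have hbΛ : b ∈ (fun q => A q + t₀) '' fccStacking 1 (Real.sqrt (2 / 3)) := by
      obtain ⟨q, hq, hqt⟩ := ht'Λ
      refine ⟨q + ((k + 1 : ℕ) : ℝ) • u, add_natCast_smul_mem_fcc hq (mem_fcc_of_mem_fccSlots hu) (k + 1), ?_⟩
      show A (q + ((k + 1 : ℕ) : ℝ) • u) + t₀ = b
      rw [hb, ← hqt, map_add, LinearIsometryEquiv.map_smul]; push_cast; module
    have hblat : Real.sqrt (b 0 ^ 2 + b 1 ^ 2) ≤ ρ' := by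
      have h1 := sqrt_lateral_add_le t' (A u + (k : ℝ) • A u)
      have e1 : t' + (A u + (k : ℝ) • A u) = b := by rw [hb]; abel
      rw [e1] at h1
      have h2 : ‖A u + (k : ℝ) • A u‖ = (k : ℝ) + 1 := by
        rw [show A u + (k : ℝ) • A u = ((k : ℝ) + 1) • A u by module, norm_smul, LinearIsometryEquiv.norm_map,
          norm_eq_one_of_mem_fccSlots hu, mul_one, Real.norm_eq_abs, abs_of_nonneg (by positivity)]
      have h3 : Real.sqrt (t' 0 ^ 2 + t' 1 ^ 2) ≤ ρs := by
        rw [← Real.sqrt_sq hρs]; exact Real.sqrt_le_sqrt ht'r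
      linarith
    have hfull : ∀ w ∈ fccSlots, b + A w ∈ X := hdeep b hbX hbΛ hblo hbHd hblat
    rw [walkRun_succ', IH', walkRun_succ_of_some X z 0 (walkStep_of_full X z b ⟨A, u, 0⟩ [] hfull), walkRun_zero]
    refine Prod.ext ?_ rfl
    show b + A u = t' + A u + ((k + 1 : ℕ) : ℝ) • A u
    rw [hb]; push_cast; module

include hX hs₀ hcert hz hu hsteep hρs hS hfullS hdeep hroom hconv in
/-- **A walker never visits another top's start state.**  For `t, t′ ∈ S` with `t′` a top (`t′ + A u ∉ S`):
if the walk from `t′ + A u` is at the state `(t + A u, bottom stack)` after `i` steps then `t = t′`. -/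
theorem walkRun_ne_start {t t' : EuclideanSpace ℝ (Fin 3)} (ht : t ∈ S) (ht' : t' ∈ S) (htop' : t' + A u ∉ S)
    (i : ℕ) (h : walkRun X z i (t' + A u, [⟨A, u, 0⟩]) = (t + A u, [⟨A, u, 0⟩])) : t = t' := by
  induction i with
  | zero =>
    rw [walkRun_zero] at h
    injection h with h1
    exact (add_right_cancel h1).symm
  | succ i IH =>
    obtain ⟨ht'X, -, -, -, -⟩ := hS t' ht'
    obtain ⟨-, -, -, htHd, -⟩ := hS t ht
    have hI₀ : WalkInv X z (t' + A u, [⟨A, u, 0⟩]) := walkInv_start A ht'X (hfullS t' ht') hu hsteep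
    rw [walkRun_succ'] at h
    obtain ⟨hwI, hwW⟩ := walkRun_valid hX hs₀ hcert hz i hI₀ (stackWF_start z A u)
    rcases hws : walkRun X z i (t' + A u, [⟨A, u, 0⟩]) with ⟨yw, stk⟩
    rw [hws] at h hwI hwW
    cases hstep : walkStep X z (yw, stk) with
    | none =>
      rw [walkRun_succ_of_none X z 0 hstep] at h
      exact IH (hws.trans h)
    | some v =>
      rw [walkRun_succ_of_some X z 0 hstep, walkRun_zero] at h
      subst h
      obtain ⟨-, hSw, ew, rw', hstk, -⟩ := hwI
      simp only at hstk hSw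
      subst hstk
      exfalso
      rcases walkStep_cases hstep with ⟨hfullw, hs⟩ | ⟨n, hcap, ⟨e', rest', hr, hn, hs⟩ | ⟨-, hs⟩⟩
      · -- FULL: `w = (t, bottom)` is on the deep prefix: `t = t′ + (i+1)·A u`
        injection hs with hy hl
        injection hl with he hr
        subst he
        have hyt : t = yw := add_right_cancel hy
        subst hyt
        have hdeepi := walkRun_deep_prefix hX hs₀ hcert hz A t₀ hu hsteep S hρs hS hfullS hdeep hroom ht' i
          (by rw [hws]; exact htHd)
        rw [hws] at hdeepi
        injection hdeepi with hy' hl'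
        have hmem : t' + (((i + 1 : ℕ)) : ℝ) • A u ∈ S := by
          have e : t' + (((i + 1 : ℕ)) : ℝ) • A u = t := by rw [hy']; push_cast; module
          rw [e]; exact ht
        exact htop' (hconv t' ht' (i + 1) (by omega) hmem)
      · -- POP: `t` would be an exact cap of the twin frame, but `t` is full in `A`
        subst hr
        injection hs with hy hl
        injection hl with he hr'
        subst he
        have hyt : t = yw := add_right_cancel hy
        subst hyt
        subst hn
        obtain ⟨hSo, hLi, -⟩ := hSw
        exact false_of_full_of_pop hX hSo hLi hcap (hfullS _ ht)
      · -- PUSH: the stack would have two levels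
        rw [pushMove_eq] at hs
        injection hs with _ hl
        injection hl with _ hl'
        exact List.cons_ne_nil _ _ hl'.symm

include hX hs₀ hcert hz hu hsteep hρs hS hfullS hdeep hroom hconv in
/-- **`top ↦ end state` is injective.**  Two tops of `S` whose walks are in the same state after `N` steps are
equal. -/
theorem walkRun_start_injective {t t' : EuclideanSpace ℝ (Fin 3)} (ht : t ∈ S) (htop : t + A u ∉ S)
    (ht' : t' ∈ S) (htop' : t' + A u ∉ S) {N : ℕ}
    (h : walkRun X z N (t + A u, [⟨A, u, 0⟩]) = walkRun X z N (t' + A u, [⟨A, u, 0⟩])) : t = t' := by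
  have hI : WalkInv X z (t + A u, [⟨A, u, 0⟩]) := walkInv_start A (hS t ht).1 (hfullS t ht) hu hsteep
  have hI' : WalkInv X z (t' + A u, [⟨A, u, 0⟩]) := walkInv_start A (hS t' ht').1 (hfullS t' ht') hu hsteep
  rcases walkRun_eq_walkRun_orbit hX hs₀ hcert hz N hI (stackWF_start z A u) hI' (stackWF_start z A u) h with
    ⟨j, hj⟩ | ⟨j, hj⟩
  · exact (walkRun_ne_start hX hs₀ hcert hz A t₀ hu hsteep S hρs hS hfullS hdeep hroom hconv ht' ht htop j hj).symm
  · exact walkRun_ne_start hX hs₀ hcert hz A t₀ hu hsteep S hρs hS hfullS hdeep hroom hconv ht ht' htop' j hj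

end Grain

end Summit.Ventures.Crystal3D.Theorems

end
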